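import Literature.NumberTheory.GaloisRepresentations.AlgebraicHeckeCharacterGrossencharakterProofs
import Literature.NumberTheory.GaloisRepresentations.AlgebraicHeckeCharacterNormValues
import Literature.NumberTheory.GaloisRepresentations.HeckeCharacterDictionary
import Literature.NumberTheory.GaloisRepresentations.HeckeCharacterOfRayClass
import Literature.NumberTheory.GaloisRepresentations.HeckeCharacterWeakApproximation
import HarnessLib

/-!
# Line `Sketch` for the crux `ReciprocityUpToIrreducibility` (item stmt-Langlands-14328), wave N11-A:
# a Hecke character of trivial infinity type `(0, 0)` has finite order

Support file (closes nothing; stub `stub_isFiniteOrder_of_hasInfinityType_zero` of the registered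
skeleton of line `Sketch`, continuation lead c9).

Let `χ` be an idelic Hecke character of the number field `K` (tree `HeckeCharacter`) with
`χ.HasInfinityType 0 0`: on a neighbourhood of `1` in `(K ⊗ ℝ)ˣ`, `χ((x, 1)) = A_{0,0}(x) = 1`.
Then `χ` has finite order (`HeckeCharacter.IsFiniteOrder χ`, i.e. `IsOfFinOrder χ`).  This is the
converse of the tree's `hasInfinityType_zero_of_isFiniteOrder` and is Neukirch VII (6.9) with (6.14):
the Größencharaktere `mod 𝔪` trivial on `𝐑^*_{(+)}` are the characters of the FINITE ray class group
`J^𝔪/P^𝔪` (Ch. VI (1.8)).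

Proof (every ingredient is a proved tree theorem):

* `χ` has a module of definition `(T, e)` (`HeckeCharacter.exists_isModulus`), with attached ideal
  `𝔪 = ∏_{v ∈ T} 𝔭_v^{e_v+1}` (`HeckeCharacter.modulusIdeal`);
* `isRayClassCharacter_of_isModulus_of_hasInfinityType_zero` — `𝔭 ↦ χ(ϖ_𝔭)` is a ray class
  character `mod 𝔪` (`LFunctions.IsRayClassCharacter`; the tree's
  `HeckeCharacter.isRayClassCharacter_of_isModulus` with "finite order" replaced by "type `(0,0)`"):
  the ray class property `χ̃((b)) = χ̃((c))` is the type-`(0,0)` case of the Größencharakter identity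
  `HasInfinityType.idealPow_span_eq` (`χ̃((b)) = χ̃((c)) · ∏_w σ_w(b/c)^{0} \overline{σ_w(b/c)}^{0}`),
  and unitarity `|χ(ϖ_𝔭)| = 1` off `T` is the weight-`0` case of
  `HasInfinityType.norm_valueAtUniformizer_sq` (`|χ(ϖ_𝔭)|² = N𝔭^0 = 1`);
* hence there is one exponent `N ≥ 1` with `χ(ϖ_𝔭)^N = 1` for all `𝔭 ∤ 𝔪`
  (`exists_pos_forall_pow_eq_one_of_isRayClassCharacter`, finiteness of `J^𝔪/P^𝔪`), i.e.
  `(χ^N)(ϖ_𝔭) = 1` for the cofinitely many `𝔭 ∉ T`, so `χ^N = 1` by rigidity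
  (`HeckeCharacter.eq_one_of_eventually_valueAtUniformizer_eq_one`, Cassels–Fröhlich VII Prop. 4.1).

References: J. Neukirch, *Algebraic Number Theory* (1999), Ch. VII §6 Prop. (6.9), Prop. (6.13),
Cor. (6.14); Ch. VI §1 Prop. (1.8)–(1.9) [NeukirchANT1999].  A. Weil, *On a certain type of
characters of the idèle-class group of an algebraic number-field* (1956), §1 [Weil1956].
-/

noncomputable section

set_option linter.dupNamespace false -- project-wide option (lakefile weak.linter.dupNamespace); `Summit.Langlands.Langlands` is the mandated namespace

open scoped NumberField Classical
open Filter IsDedekindDomain NumberField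
open Literature.NumberTheory.GaloisRepresentations

namespace Summit.Langlands.Langlands.Theorems.ReciprocityUpToIrreducibility

/-- **The Größencharakter of a Hecke character of type `(0, 0)` is a ray class character modulo any
module of definition.**  If `χ` has infinity type `(0, 0)` and module of definition `(T, e)`, then
`𝔭 ↦ χ(ϖ_𝔭)` is a ray class character modulo `𝔪 = ∏_{v ∈ T} 𝔭_v^{e_v+1}`
(`LFunctions.IsRayClassCharacter`): `|χ(ϖ_𝔭)|² = N𝔭^0 = 1` for `𝔭 ∤ 𝔪`
(`HasInfinityType.norm_valueAtUniformizer_sq` at weight `0`), and `χ̃((b)) = χ̃((c))` for nonzero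
integers `b ≡ c mod 𝔪`, `c` prime to `𝔪`, `b/c` totally positive (`HasInfinityType.idealPow_span_eq`,
whose archimedean factor `∏_w σ_w(b/c)^0 \overline{σ_w(b/c)}^0` is `1`).  Neukirch VII (6.9): the
Größencharaktere `mod 𝔪` trivial on `𝐑^*_{(+)}` are the Dirichlet characters `mod 𝔪`.
[cite: NeukirchANT1999, Ch. VII §6 Prop. (6.9) and Cor. (6.14)] -/
theorem isRayClassCharacter_of_isModulus_of_hasInfinityType_zero {K : Type*} [Field K] [NumberField K]
    {χ : HeckeCharacter K} (hinf : χ.HasInfinityType 0 0) {T : Finset (HeightOneSpectrum (𝓞 K))}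
    {e : HeightOneSpectrum (𝓞 K) → ℕ} (hmod : HeckeCharacter.IsModulus χ T e) :
    Literature.NumberTheory.LFunctions.IsRayClassCharacter (HeckeCharacter.modulusIdeal T e)
      (fun v => χ.valueAtUniformizer v) := by
  -- adapted from HeckeCharacterDictionary.isRayClassCharacter_of_isModulus: its two uses of finite order
  -- (unitarity; `χ` kills totally positive principal infinite ideles) are replaced by the weight-`0` norm
  -- identity and the type-`(0,0)` Größencharakter identity of the tree.
  refine ⟨fun v hv => ?_, fun b c hb hc hcop hbc hpos => ?_⟩
  · have hvT : v ∉ T := fun h => hv (HeckeCharacter.modulusIdeal_le_iff.mpr h)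
    have h := hinf.norm_valueAtUniformizer_sq hmod (wt := 0) (fun w => by simp) hvT
    rw [zpow_zero] at h
    exact (pow_eq_one_iff_of_nonneg (norm_nonneg _) two_ne_zero).mp h
  · have h := hinf.idealPow_span_eq hmod hb hc hcop hbc hpos
    simpa only [Pi.zero_apply, zpow_zero, mul_one, Finset.prod_const_one] using h

/-- **stub N11-A (Neukirch VII (6.9), (6.14)): a Hecke character with trivial infinity type `(0, 0)` has
finite order.**  With a module of definition `(T, e)` of `χ` (`HeckeCharacter.exists_isModulus`),
`𝔭 ↦ χ(ϖ_𝔭)` is a character of the finite ray class group modulo `𝔪(T, e)`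
(`isRayClassCharacter_of_isModulus_of_hasInfinityType_zero`), whence one exponent `N ≥ 1` with
`χ(ϖ_𝔭)^N = 1` for all `𝔭 ∤ 𝔪` (`exists_pos_forall_pow_eq_one_of_isRayClassCharacter`); so
`(χ^N)(ϖ_𝔭) = 1` for all `𝔭 ∉ T` and `χ^N = 1` by rigidity
(`HeckeCharacter.eq_one_of_eventually_valueAtUniformizer_eq_one`).
[cite: NeukirchANT1999, Ch. VII §6 Prop. (6.9) and Cor. (6.14)] -/
theorem stub_isFiniteOrder_of_hasInfinityType_zero :
    ∀ (K : Type) [Field K] [NumberField K] (χ : HeckeCharacter K),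
      χ.HasInfinityType 0 0 → χ.IsFiniteOrder := by
  intro K _ _ χ hinf
  obtain ⟨T, e, hmod⟩ := χ.exists_isModulus
  obtain ⟨N, hN, hpow⟩ := exists_pos_forall_pow_eq_one_of_isRayClassCharacter
    (HeckeCharacter.modulusIdeal_ne_bot T e)
    (isRayClassCharacter_of_isModulus_of_hasInfinityType_zero hinf hmod)
  -- `χ ^ N = 1` by rigidity: `(χ ^ N)(ϖ_v) = χ(ϖ_v) ^ N = 1` for every `v ∉ T`
  refine isOfFinOrder_iff_pow_eq_one.mpr ⟨N, hN, ?_⟩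
  refine HeckeCharacter.eq_one_of_eventually_valueAtUniformizer_eq_one
    (T.eventually_cofinite_notMem.mono fun v hvT => ?_)
  have h1 := hpow v fun h => hvT (HeckeCharacter.modulusIdeal_le_iff.mp h)
  simp only [HeckeCharacter.valueAtUniformizer, HeckeCharacter.localComponent_apply,
    HeckeCharacter.pow_apply, Units.val_pow_eq_pow_val] at h1 ⊢
  exact h1

end Summit.Langlands.Langlands.Theorems.ReciprocityUpToIrreducibility

end
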